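import Summits.Ventures.LatticeQCDFlow.Scoring.UNFluxSectors
import HarnessLib

/-!
# The Heine–Szegő identity for `U(N)`: a multiplicative class weight `Π_b w(θ_b)` integrates to the Toeplitz determinant `det[ŵ(i−j)]`

HONEST FRAMING: exact (Metropolis-corrected) sampling algorithms for lattice gauge theory;
figures of merit are autocorrelation/cost numbers at stated couplings and volumes; no
continuum-physics claim.

Venture `LatticeQCDFlow` (cell pub-lqcd), sub-topic `Scoring`; FANOUT row 5 (`s0-sun-a`), GEN-17.
NEW WORK of the cell (placement rule).  `BesselToeplitzAndreief` / `UNOnePlaquetteBesselDeterminant` /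
`UNFluxSectors` treat the Wilson weight `e^{x cos θ}` (and its flux twists); the argument only uses that the
class weight is a PRODUCT over the eigen-angles.  This file records the general statement (Heine 1878 / Szegő;
Andréief 1883), the tool for every "single-plaquette action that is multiplicative in the eigenvalues" (mixed
fundamental actions `Σ_k x_k Re tr U^k`, flux insertions `det^q`, heat-kernel-type weights):

* §1 **cube form**: for ANY `w` integrable on `(−π, π]`,
  `∫_{(−π,π]^N} (Π_b w(θ_b)) |Δ(e^{iθ})|² dθ = N! · det[ŵ(i − j)]_{i,j}`, `ŵ(m) = ∫_{(−π,π]} w(θ) e^{imθ} dθ`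
  (Leibniz double expansion of `|Δ|²`, Fubini, the tree's Andréief identity);
* §2 **Haar form**: for every continuous class function `F : U(n) → ℂ` whose restriction to the diagonal torus is
  multiplicative, `F(diag e^{iθ}) = Π_b w(θ_b)` with `w` integrable on `(−π,π]`,
  `∫_{U(n)} F dU = (2π)^{−N} det[ŵ(i − j)]_{i,j : Fin N}` — i.e. `det` of the Toeplitz matrix of the NORMALISED
  Fourier coefficients `(2π)⁻¹ŵ`; `w = e^{x cos θ}` is part 2 (`ŵ(m) = 2π I_{|m|}(x)`), `w = e^{x cos θ}e^{iqθ}` the flux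
  sectors.

No `def`, nothing cited as a fact, 0 sorry.
-/

noncomputable section

open Real MeasureTheory Finset Complex Equiv
open scoped ENNReal
open Literature.MathematicalPhysics.QuantumFieldTheory (haarProbability)
open Literature.Analysis.FunctionSpaces (besselI)
open Literature.RepresentationTheory.CompactGroups.WeylIntegration
open Literature.LinearAlgebra.Matrix (diagonalTorus)

namespace Summit.Ventures.LatticeQCDFlow.Scoring

variable {n : Type*} [Fintype n] [DecidableEq n]

/-! ### 1. The cube form: any integrable weight -/

/-- One twisted factor `w(θ) e^{ikθ}` is integrable on `(−π, π]` when `w` is. -/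
theorem integrableOn_mul_cexp_int {w : ℝ → ℂ} (hw : IntegrableOn w (Set.Ioc (-π) π)) (k : ℤ) :
    Integrable (fun θ : ℝ => w θ * cexp ((k : ℂ) * θ * I)) ((volume : Measure ℝ).restrict (Set.Ioc (-π) π)) := by
  refine Integrable.mul_bdd (c := 1) hw (Continuous.aestronglyMeasurable (by fun_prop))
    (Filter.Eventually.of_forall fun θ => ?_)
  rw [show (k : ℂ) * (θ : ℂ) * I = (((k : ℝ) * θ : ℝ) : ℂ) * I by push_cast; ring, Complex.norm_exp_ofReal_mul_I]

/-- Each term of the Leibniz double expansion, with the product weight, is integrable on the cube. -/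
theorem integrable_cube_weight_term {w : ℝ → ℂ} (hw : IntegrableOn w (Set.Ioc (-π) π)) (σ τ : Perm n) :
    Integrable (fun θ : n → ℝ => ((Equiv.Perm.sign σ : ℤ) : ℂ) * ((Equiv.Perm.sign τ : ℤ) : ℂ) *
        ∏ b, (w (θ b) * cexp ((charVec σ b - charVec τ b : ℤ) * θ b * I)))
      (Measure.pi fun _ : n => (volume : Measure ℝ).restrict (Set.Ioc (-π) π)) :=
  (Integrable.fintype_prod (f := fun b (t : ℝ) => w t * cexp ((charVec σ b - charVec τ b : ℤ) * t * I))
    fun _ => integrableOn_mul_cexp_int hw _).const_mul _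

/-- **THE HEINE–ANDRÉIEF IDENTITY ON THE CUBE**: for every `w` integrable on `(−π, π]`,
`∫_{(−π,π]^N} (Π_b w(θ_b)) |Δ(e^{iθ})|² dθ = N! · det[ŵ(i − j)]_{i,j}`, `ŵ(m) = ∫_{(−π,π]} w(θ) e^{imθ} dθ`
(entries indexed by `n` through `enum n`). -/
theorem integral_cube_prod_weight_mul_norm_vdm_sq {w : ℝ → ℂ} (hw : IntegrableOn w (Set.Ioc (-π) π)) :
    ∫ θ, (∏ b, w (θ b)) * ((‖vdm θ‖ ^ 2 : ℝ) : ℂ)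
        ∂(Measure.pi fun _ : n => (volume : Measure ℝ).restrict (Set.Ioc (-π) π))
      = (Fintype.card n).factorial *
          (Matrix.of fun i j : n =>
            ∫ θ in Set.Ioc (-π) π, w θ * cexp (((((enum n i : ℕ) : ℤ) - ((enum n j : ℕ) : ℤ) : ℤ) : ℂ) * θ * I)).det := by
  have hexp : ∀ θ : n → ℝ, (∏ b, w (θ b)) * ((‖vdm θ‖ ^ 2 : ℝ) : ℂ)
      = ∑ σ : Perm n, ∑ τ : Perm n, ((Equiv.Perm.sign σ : ℤ) : ℂ) * ((Equiv.Perm.sign τ : ℤ) : ℂ) *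
          ∏ b, (w (θ b) * cexp ((charVec σ b - charVec τ b : ℤ) * θ b * I)) := by
    intro θ
    rw [norm_vdm_sq_eq_sum, Finset.mul_sum]
    refine Finset.sum_congr rfl fun σ _ => ?_
    rw [Finset.mul_sum]
    refine Finset.sum_congr rfl fun τ _ => ?_
    rw [Finset.prod_mul_distrib]
    ring
  simp_rw [hexp]
  rw [integral_finsetSum _ (fun σ _ => integrable_finsetSum _ fun τ _ => integrable_cube_weight_term hw σ τ)]
  simp_rw [integral_finsetSum _ (fun τ _ => integrable_cube_weight_term hw _ τ), integral_const_mul]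
  have hI : ∀ σ τ : Perm n,
      ∫ θ, ∏ b, (w (θ b) * cexp ((charVec σ b - charVec τ b : ℤ) * θ b * I))
        ∂(Measure.pi fun _ : n => (volume : Measure ℝ).restrict (Set.Ioc (-π) π))
      = ∏ b, ∫ θ in Set.Ioc (-π) π,
          w θ * cexp (((((enum n (σ.symm b) : ℕ) : ℤ) - ((enum n (τ.symm b) : ℕ) : ℤ) : ℤ) : ℂ) * θ * I) := by
    intro σ τ
    rw [integral_fintype_prod_eq_prod (𝕜 := ℂ)
      (fun b (θ : ℝ) => w θ * cexp ((charVec σ b - charVec τ b : ℤ) * θ * I))]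
    rfl
  simp_rw [hI]
  have key := sum_sum_sign_mul_sign_mul_prod_eq_factorial_mul_det
    (Matrix.of fun i j : n =>
      ∫ θ in Set.Ioc (-π) π, w θ * cexp (((((enum n i : ℕ) : ℤ) - ((enum n j : ℕ) : ℤ) : ℤ) : ℂ) * θ * I))
  simp only [Matrix.of_apply] at key
  rw [key]

/-! ### 2. The Haar form: multiplicative class functions on `U(n)` -/

/-- Reindexing the Toeplitz determinant of Fourier coefficients from `n` (through `enum n`) to `Fin N`. -/
theorem det_fourier_toeplitz_enum_eq (c : ℤ → ℂ) :
    (Matrix.of fun i j : n => c (((enum n i : ℕ) : ℤ) - ((enum n j : ℕ) : ℤ))).det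
      = (Matrix.of fun i j : Fin (Fintype.card n) => c ((i : ℤ) - (j : ℤ))).det := by
  rw [show (Matrix.of fun i j : n => c (((enum n i : ℕ) : ℤ) - ((enum n j : ℕ) : ℤ)))
      = (Matrix.of fun i j : Fin (Fintype.card n) => c ((i : ℤ) - (j : ℤ))).submatrix (enum n) (enum n) from
    by ext i j; rfl, Matrix.det_submatrix_equiv_self]

/-- **THE HEINE–SZEGŐ IDENTITY FOR `U(n)`**: for a continuous class function `F : U(n) → ℂ` which is
MULTIPLICATIVE on the diagonal torus — `F(diag(e^{iθ})) = Π_b w(θ_b)` for some `w` integrable on `(−π, π]` — one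
has `∫_{U(n)} F dU = (2π)^{−N} · det[ŵ(i − j)]_{i,j : Fin N}` with `ŵ(m) = ∫_{(−π,π]} w(θ) e^{imθ} dθ`, i.e. the
`N × N` Toeplitz determinant of the normalised Fourier coefficients `(2π)⁻¹ ŵ` of the one-angle weight. -/
theorem integral_haar_unitaryGroup_multiplicative_classFun {F : Matrix.unitaryGroup n ℂ → ℂ} (hF : Continuous F)
    (hcl : ∀ g u : Matrix.unitaryGroup n ℂ, F (g * u * g⁻¹) = F u) {w : ℝ → ℂ}
    (hw : IntegrableOn w (Set.Ioc (-π) π))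
    (hFw : ∀ θ : n → ℝ, F ((torusPt θ : diagonalTorus n) : Matrix.unitaryGroup n ℂ) = ∏ b, w (θ b)) :
    ∫ u, F u ∂(haarProbability (Matrix.unitaryGroup n ℂ))
      = ((((2 * π) ^ Fintype.card n)⁻¹ : ℝ) : ℂ) *
          (Matrix.of fun i j : Fin (Fintype.card n) =>
            ∫ θ in Set.Ioc (-π) π, w θ * cexp ((((i : ℤ) - (j : ℤ) : ℤ) : ℂ) * θ * I)).det := by
  rw [integral_haar_unitaryGroup_classFun_complex hF hcl]
  simp_rw [hFw, prod_OD_norm_sub_sq_eq_norm_vdm_sq]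
  rw [integral_cube_prod_weight_mul_norm_vdm_sq hw,
    det_fourier_toeplitz_enum_eq (fun m : ℤ => ∫ θ in Set.Ioc (-π) π, w θ * cexp ((m : ℂ) * θ * I)), ← mul_assoc]
  congr 1
  have hN : ((Fintype.card n).factorial : ℂ) ≠ 0 := Nat.cast_ne_zero.2 (Nat.factorial_ne_zero _)
  have hπ : ((2 * π : ℝ) : ℂ) ≠ 0 := by exact_mod_cast (by positivity : (2 * π : ℝ) ≠ 0)
  push_cast
  field_simp

omit [DecidableEq n] in
/-- Sanity check against part 2: with `w(θ) = e^{x cos θ}` (`ŵ(m) = 2π I_{|m|}(x)`) the Heine–Szegő identity is the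
Bars–Green determinant `∫_{U(n)} e^{x Re tr U} dU = det[I_{|i−j|}(x)]`. -/
theorem heineSzego_wilsonWeight (x : ℝ) :
    ((((2 * π) ^ Fintype.card n)⁻¹ : ℝ) : ℂ) *
        (Matrix.of fun i j : Fin (Fintype.card n) =>
          ∫ θ in Set.Ioc (-π) π, cexp ((x : ℂ) * Real.cos θ) * cexp ((((i : ℤ) - (j : ℤ) : ℤ) : ℂ) * θ * I)).det
      = ((Matrix.of fun i j : Fin (Fintype.card n) => besselI ((i : ℤ) - (j : ℤ)).natAbs x).det : ℂ) := by
  simp_rw [integral_Ioc_cexp_mul_cos_mul_cexp_int]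
  rw [show (Matrix.of fun i j : Fin (Fintype.card n) => 2 * (π : ℂ) * (besselI ((i : ℤ) - (j : ℤ)).natAbs x : ℂ))
      = (2 * (π : ℂ)) • (Matrix.of fun i j : Fin (Fintype.card n) => (besselI ((i : ℤ) - (j : ℤ)).natAbs x : ℂ)) from by
    ext i j; simp [mul_assoc], Matrix.det_smul, Fintype.card_fin,
    ← Complex.ofRealHom_eq_coe ((Matrix.of fun i j : Fin (Fintype.card n) => besselI ((i : ℤ) - (j : ℤ)).natAbs x).det),
    RingHom.map_det, ← mul_assoc]
  have hπ : (2 : ℂ) * (π : ℂ) ≠ 0 := mul_ne_zero two_ne_zero (Complex.ofReal_ne_zero.2 Real.pi_ne_zero)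
  push_cast
  rw [inv_mul_cancel₀ (pow_ne_zero _ hπ), one_mul]
  congr 1

end Summit.Ventures.LatticeQCDFlow.Scoring
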